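import Mathlib
import Summits.Ventures.PercRepro2.AsymPins

/-!
# The cross-sectioning identity for (AS3) and the good-coordinate reduction
(seat mine-b, cell pub-perc-repro2; conjectures/MINE-B.md §15, proofs/MINE-B-CROSSSECTION.md)

For increasing events `A`, `B` on the cube `𝒫(U)` (`γ` blue, `ρ = U \ γ` red) the level-refined Reimer
statement (AS3) is `#{A □ B at γ ∧ ρ ∉ B} ≤ #{A γ ∧ B ρ ∧ ¬ B □ B at ρ}`; by the colour swap it is the
non-negativity of the TWO-TERM functional
  `Φ(U; A, B) = #{A γ ∧ B ρ} − #{A □ B at γ ∧ ρ ∉ B} − #{B □ B at γ ∧ ρ ∈ A}`   (`AS3_iff_Phi_nonneg`).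

Sectioning at a coordinate `i ∉ U′` (`U = insert i U′`; `A₁ = sec1 i A = A (insert i ·)`, `B₁` likewise):
  **`Φ(insert i U′; A, B) = Φ(U′; A, B₁) + Φ(U′; A₁, B) + D_i + E_i − N_i`**   (`Phi_insert`), where
  `D_i = #{B₁ □ B₁ ∧ ¬ B □ B₁ at γ′ ∧ ρ′ ∈ A}` (two blue `B`-witnesses disjoint only because both use `i`),
  `E_i = #{A □ B₁ ∧ A₁ □ B ∧ ¬ A □ B at γ′ ∧ ρ′ ∉ B}` (`i` usable on either side, needed),
  `N_i = #{A □ B₁ ∧ ¬ A □ B at γ′ ∧ ρ′ ∪ i ∈ B ∧ ρ′ ∉ B}` (the doubly pivotal configurations).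
This refines the Bollobás–Leader step of `reimer_increasing` (where the surplus is `≥ 0` automatically);
here the surplus `D_i + E_i − N_i` can be negative, so an induction must CHOOSE the coordinate:

* `AS3_of_goodCoordinate` — if every pair of increasing events on every nonempty cube either satisfies
  (AS3) outright or has a coordinate `i` with `N_i ≤ D_i + E_i`, then (AS3) holds for every pair on every
  finite cube (induction on the cube; the cross pairs `(A, B₁)`, `(A₁, B)` are not nested, which is why the
  statement is for all pairs);
* `cN_le_cE_of_minB_sub` — a PROVED sufficient condition: for `A ⊆ B`, if every minimal member of `B`
  containing `i` lies in `A` (every `B`-witness through `i` is an `A`-witness), then `N_i ≤ E_i`, so `i` is good.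

Census (MINE-B.md §15.2): every nested pair on ≤ 5 elements has a good coordinate, and every pair at
n = 5 except `A ∈ {⊤, {γ ≠ ∅}}` (where (AS3) is Reimer's inequality) — nothing here depends on it.
-/

open Finset

namespace Summit.Ventures.PercRepro2

namespace StepZero

open ReimerCube

variable {E : Type*} [DecidableEq E]

open Classical

omit [DecidableEq E] in
/-- disjoint occurrence is symmetric -/
lemma dOcc_comm {A B : Finset E → Prop} {S : Finset E} (h : DOcc A B S) : DOcc B A S := by
  obtain ⟨K, L, hK, hL, hKL, hA, hB⟩ := h
  exact ⟨L, K, hL, hK, hKL.symm, hB, hA⟩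

/-! ## The three counts and the two-term functional -/

/-- the Reimer targets `#{γ ⊆ U : A γ ∧ B (U \ γ)}` -/
noncomputable def cT (U : Finset E) (A B : Finset E → Prop) : ℕ :=
  (U.powerset.filter (fun γ => A γ ∧ B (U \ γ))).card

/-- the (AS3) sources `#{γ ⊆ U : A □ B at γ ∧ U \ γ ∉ B}` -/
noncomputable def cL (U : Finset E) (A B : Finset E → Prop) : ℕ :=
  (U.powerset.filter (fun γ => DOcc A B γ ∧ ¬ B (U \ γ))).card

/-- the second term `#{γ ⊆ U : B □ B at γ ∧ U \ γ ∈ A}` (the swapped excluded targets) -/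
noncomputable def cM (U : Finset E) (A B : Finset E → Prop) : ℕ :=
  (U.powerset.filter (fun γ => DOcc B B γ ∧ A (U \ γ))).card

/-- the two-term functional `Φ(U; A, B) = cT − cL − cM` (an integer) -/
noncomputable def Phi (U : Finset E) (A B : Finset E → Prop) : ℤ :=
  (cT U A B : ℤ) - cL U A B - cM U A B

/-- the Reimer targets split by `B □ B` on the red side: `cT = #{A γ ∧ B ρ ∧ ¬ B □ B ρ} + cM` -/
lemma cT_eq_add_cM (U : Finset E) (A B : Finset E → Prop) :
    cT U A B = (U.powerset.filter (fun γ => A γ ∧ B (U \ γ) ∧ ¬ DOcc B B (U \ γ))).card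
      + cM U A B := by
  unfold cT cM
  rw [← Finset.card_filter_add_card_filter_not (fun γ => DOcc B B (U \ γ))
    (s := U.powerset.filter (fun γ => A γ ∧ B (U \ γ))), Finset.filter_filter, Finset.filter_filter,
    Nat.add_comm]
  congr 1
  · apply congrArg Finset.card
    apply Finset.filter_congr
    intro γ _
    constructor
    · rintro ⟨⟨h1, h2⟩, h3⟩; exact ⟨h1, h2, h3⟩
    · rintro ⟨h1, h2, h3⟩; exact ⟨⟨h1, h2⟩, h3⟩
  · have e : (U.powerset.filter (fun γ => (A γ ∧ B (U \ γ)) ∧ DOcc B B (U \ γ))).card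
        = (U.powerset.filter (fun γ => A γ ∧ DOcc B B (U \ γ))).card := by
      apply congrArg Finset.card
      apply Finset.filter_congr
      intro γ _
      constructor
      · rintro ⟨⟨h1, -⟩, h2⟩; exact ⟨h1, h2⟩
      · rintro ⟨h1, h2⟩; exact ⟨⟨h1, (A_and_B_of_dOcc h2).1⟩, h2⟩
    rw [e, card_filter_swap A (fun X => DOcc B B X) U]

/-- **(AS3) is the non-negativity of `Φ`.** -/
theorem AS3_iff_Phi_nonneg (U : Finset E) (A B : Finset E → Prop) :
    AS3 U A B ↔ 0 ≤ Phi U A B := by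
  unfold AS3 Phi
  rw [cT_eq_add_cM]
  unfold cL
  constructor
  · intro h; push_cast; omega
  · intro h; push_cast at h; omega

/-! ## Sectioning at a coordinate -/

/-- `D_i`: two blue `B`-witnesses disjoint only because both use `i`, no genuinely disjoint pair, red in `A` -/
noncomputable def cD (U' : Finset E) (A B : Finset E → Prop) (i : E) : ℕ :=
  (U'.powerset.filter (fun γ => DOcc (sec1 i B) (sec1 i B) γ ∧ ¬ DOcc B (sec1 i B) γ ∧ A (U' \ γ))).card

/-- `E_i`: blue reaches `A □ B` with `i` on either side but not without `i`, red not in `B` -/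
noncomputable def cE (U' : Finset E) (A B : Finset E → Prop) (i : E) : ℕ :=
  (U'.powerset.filter (fun γ => DOcc A (sec1 i B) γ ∧ DOcc (sec1 i A) B γ ∧ ¬ DOcc A B γ
    ∧ ¬ B (U' \ γ))).card

/-- `N_i`: the doubly pivotal configurations — blue reaches `A □ B` only with `i` in the `B`-witness,
red is in `B` only with `i` -/
noncomputable def cN (U' : Finset E) (A B : Finset E → Prop) (i : E) : ℕ :=
  (U'.powerset.filter (fun γ => DOcc A (sec1 i B) γ ∧ ¬ DOcc A B γ ∧ B (insert i (U' \ γ))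
    ∧ ¬ B (U' \ γ))).card

/-- the complement identities on `insert i U'` -/
lemma insert_sdiff_insert_of_notMem (U' γ : Finset E) {i : E} (hi : i ∉ U') :
    insert i U' \ insert i γ = U' \ γ := by
  rw [Finset.insert_sdiff_insert, Finset.sdiff_insert_of_notMem hi]

/-- `(insert i U') \ γ = insert i (U' \ γ)` for `γ ⊆ U'`, `i ∉ U'` -/
lemma insert_sdiff_of_subset {U' γ : Finset E} {i : E} (hγ : γ ⊆ U') (hi : i ∉ U') :
    insert i U' \ γ = insert i (U' \ γ) :=
  Finset.insert_sdiff_of_notMem U' (fun h => hi (hγ h))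

/-- `cT` on `insert i U'` -/
lemma cT_insert (U' : Finset E) {i : E} (hi : i ∉ U') (A B : Finset E → Prop) :
    cT (insert i U') A B = cT U' A (sec1 i B) + cT U' (sec1 i A) B := by
  unfold cT
  rw [card_filter_powerset_insert hi]
  congr 1
  · apply congrArg Finset.card; apply Finset.filter_congr; intro γ hγ
    rw [Finset.mem_powerset] at hγ
    rw [insert_sdiff_of_subset hγ hi]; rfl
  · apply congrArg Finset.card; apply Finset.filter_congr; intro γ hγ
    rw [Finset.mem_powerset] at hγ
    rw [insert_sdiff_insert_of_notMem U' γ hi]; rfl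

/-- `cL` on `insert i U'`, in sectioned form -/
lemma cL_insert (U' : Finset E) {i : E} (hi : i ∉ U') {A B : Finset E → Prop} (hB : Incr B) :
    cL (insert i U') A B
      = (U'.powerset.filter (fun γ => DOcc A B γ ∧ ¬ B (insert i (U' \ γ)))).card
        + (U'.powerset.filter (fun γ => (DOcc A (sec1 i B) γ ∨ DOcc (sec1 i A) B γ)
            ∧ ¬ B (U' \ γ))).card := by
  unfold cL
  rw [card_filter_powerset_insert hi]
  congr 1
  · apply congrArg Finset.card; apply Finset.filter_congr; intro γ hγ
    rw [Finset.mem_powerset] at hγ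
    rw [insert_sdiff_of_subset hγ hi]
  · apply congrArg Finset.card; apply Finset.filter_congr; intro γ hγ
    rw [Finset.mem_powerset] at hγ
    rw [insert_sdiff_insert_of_notMem U' γ hi, dOcc_insert_iff hB (fun h => hi (hγ h))]

/-- `cM` on `insert i U'`, in sectioned form -/
lemma cM_insert (U' : Finset E) {i : E} (hi : i ∉ U') {A B : Finset E → Prop} (hB : Incr B) :
    cM (insert i U') A B
      = (U'.powerset.filter (fun γ => DOcc B B γ ∧ A (insert i (U' \ γ)))).card
        + (U'.powerset.filter (fun γ => DOcc B (sec1 i B) γ ∧ A (U' \ γ))).card := by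
  unfold cM
  rw [card_filter_powerset_insert hi]
  congr 1
  · apply congrArg Finset.card; apply Finset.filter_congr; intro γ hγ
    rw [Finset.mem_powerset] at hγ
    rw [insert_sdiff_of_subset hγ hi]
  · apply congrArg Finset.card; apply Finset.filter_congr; intro γ hγ
    rw [Finset.mem_powerset] at hγ
    rw [insert_sdiff_insert_of_notMem U' γ hi, dOcc_insert_iff hB (fun h => hi (hγ h))]
    constructor
    · rintro ⟨h | h, h2⟩
      · exact ⟨h, h2⟩
      · exact ⟨dOcc_comm h, h2⟩
    · rintro ⟨h, h2⟩; exact ⟨Or.inl h, h2⟩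

/-! ## The cross-sectioning identity -/

/-- `B □ B₁` implies `B₁ □ B₁` -/
lemma dOcc_self_sec1 {B : Finset E → Prop} (hB : Incr B) (i : E) {γ : Finset E}
    (h : DOcc B (sec1 i B) γ) : DOcc (sec1 i B) (sec1 i B) γ :=
  DOcc.mono_left (fun T hT => incr_le_sec1 hB i T hT) h

/-- `A □ B` implies `A □ B₁` -/
lemma dOcc_sec1_right {A B : Finset E → Prop} (hB : Incr B) (i : E) {γ : Finset E}
    (h : DOcc A B γ) : DOcc A (sec1 i B) γ :=
  DOcc.mono_right (fun T hT => incr_le_sec1 hB i T hT) h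

/-- `A □ B` implies `A₁ □ B` -/
lemma dOcc_sec1_left {A B : Finset E → Prop} (hA : Incr A) (i : E) {γ : Finset E}
    (h : DOcc A B γ) : DOcc (sec1 i A) B γ :=
  DOcc.mono_left (fun T hT => incr_le_sec1 hA i T hT) h

/-- `cL` of the pair `(A, B₁)`, in canonical form (definitional) -/
lemma cL_sec1_right (U' : Finset E) (A B : Finset E → Prop) (i : E) :
    cL U' A (sec1 i B)
      = (U'.powerset.filter (fun γ => DOcc A (sec1 i B) γ ∧ ¬ B (insert i (U' \ γ)))).card := rfl

/-- `cM` of the pair `(A, B₁)`, in canonical form (definitional) -/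
lemma cM_sec1_right (U' : Finset E) (A B : Finset E → Prop) (i : E) :
    cM U' A (sec1 i B)
      = (U'.powerset.filter (fun γ => DOcc (sec1 i B) (sec1 i B) γ ∧ A (U' \ γ))).card := rfl

/-- `cL` of the pair `(A₁, B)`, in canonical form (definitional) -/
lemma cL_sec1_left (U' : Finset E) (A B : Finset E → Prop) (i : E) :
    cL U' (sec1 i A) B
      = (U'.powerset.filter (fun γ => DOcc (sec1 i A) B γ ∧ ¬ B (U' \ γ))).card := rfl

/-- `cM` of the pair `(A₁, B)`, in canonical form (definitional) -/
lemma cM_sec1_left (U' : Finset E) (A B : Finset E → Prop) (i : E) :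
    cM U' (sec1 i A) B
      = (U'.powerset.filter (fun γ => DOcc B B γ ∧ A (insert i (U' \ γ)))).card := rfl

/-- **The cross-sectioning identity**: for `i ∉ U'` and increasing `A`, `B`,
`Φ(insert i U'; A, B) = Φ(U'; A, B₁) + Φ(U'; A₁, B) + D_i + E_i − N_i`. -/
theorem Phi_insert (U' : Finset E) {i : E} (hi : i ∉ U') {A B : Finset E → Prop} (hA : Incr A)
    (hB : Incr B) :
    Phi (insert i U') A B
      = Phi U' A (sec1 i B) + Phi U' (sec1 i A) B + cD U' A B i + cE U' A B i - cN U' A B i := by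
  -- the sectioned counts
  have hT := cT_insert U' hi A B
  have hL := cL_insert U' hi (A := A) hB
  have hM := cM_insert U' hi (A := A) hB
  -- (F1): `#{B₁□B₁ ∧ ρ' ∈ A} = #{B□B₁ ∧ ρ' ∈ A} + D_i`
  have F1 : (U'.powerset.filter (fun γ => DOcc (sec1 i B) (sec1 i B) γ ∧ A (U' \ γ))).card
      = (U'.powerset.filter (fun γ => DOcc B (sec1 i B) γ ∧ A (U' \ γ))).card + cD U' A B i := by
    unfold cD
    rw [← Finset.card_filter_add_card_filter_not (fun γ => DOcc B (sec1 i B) γ)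
      (s := U'.powerset.filter (fun γ => DOcc (sec1 i B) (sec1 i B) γ ∧ A (U' \ γ))),
      Finset.filter_filter, Finset.filter_filter]
    congr 1
    · apply congrArg Finset.card; apply Finset.filter_congr; intro γ _; constructor
      · rintro ⟨⟨-, h2⟩, h3⟩; exact ⟨h3, h2⟩
      · rintro ⟨h1, h2⟩; exact ⟨⟨dOcc_self_sec1 hB i h1, h2⟩, h1⟩
    · apply congrArg Finset.card; apply Finset.filter_congr; intro γ _; constructor
      · rintro ⟨⟨h1, h2⟩, h3⟩; exact ⟨h1, h3, h2⟩
      · rintro ⟨h1, h2, h3⟩; exact ⟨⟨h1, h3⟩, h2⟩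
  -- (F2): inclusion–exclusion for `X ∨ Y`
  have F2 : (U'.powerset.filter (fun γ => (DOcc A (sec1 i B) γ ∨ DOcc (sec1 i A) B γ)
      ∧ ¬ B (U' \ γ))).card
      + (U'.powerset.filter (fun γ => DOcc A (sec1 i B) γ ∧ DOcc (sec1 i A) B γ
          ∧ ¬ B (U' \ γ))).card
      = (U'.powerset.filter (fun γ => DOcc A (sec1 i B) γ ∧ ¬ B (U' \ γ))).card
        + (U'.powerset.filter (fun γ => DOcc (sec1 i A) B γ ∧ ¬ B (U' \ γ))).card := by
    have hu : U'.powerset.filter (fun γ => (DOcc A (sec1 i B) γ ∨ DOcc (sec1 i A) B γ)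
        ∧ ¬ B (U' \ γ))
        = U'.powerset.filter (fun γ => DOcc A (sec1 i B) γ ∧ ¬ B (U' \ γ))
          ∪ U'.powerset.filter (fun γ => DOcc (sec1 i A) B γ ∧ ¬ B (U' \ γ)) := by
      ext γ; simp only [Finset.mem_filter, Finset.mem_union]; tauto
    have hi' : U'.powerset.filter (fun γ => DOcc A (sec1 i B) γ ∧ DOcc (sec1 i A) B γ
        ∧ ¬ B (U' \ γ))
        = U'.powerset.filter (fun γ => DOcc A (sec1 i B) γ ∧ ¬ B (U' \ γ))
          ∩ U'.powerset.filter (fun γ => DOcc (sec1 i A) B γ ∧ ¬ B (U' \ γ)) := by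
      ext γ; simp only [Finset.mem_filter, Finset.mem_inter]; tauto
    rw [hu, hi']
    exact Finset.card_union_add_card_inter _ _
  -- (F3): `#{X ∧ Y ∧ ¬b0} = #{Z ∧ ¬b0} + E_i`
  have F3 : (U'.powerset.filter (fun γ => DOcc A (sec1 i B) γ ∧ DOcc (sec1 i A) B γ
      ∧ ¬ B (U' \ γ))).card
      = (U'.powerset.filter (fun γ => DOcc A B γ ∧ ¬ B (U' \ γ))).card + cE U' A B i := by
    unfold cE
    rw [← Finset.card_filter_add_card_filter_not (fun γ => DOcc A B γ)
      (s := U'.powerset.filter (fun γ => DOcc A (sec1 i B) γ ∧ DOcc (sec1 i A) B γ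
        ∧ ¬ B (U' \ γ))), Finset.filter_filter, Finset.filter_filter]
    congr 1
    · apply congrArg Finset.card; apply Finset.filter_congr; intro γ _; constructor
      · rintro ⟨⟨-, -, h3⟩, h4⟩; exact ⟨h4, h3⟩
      · rintro ⟨h1, h2⟩; exact ⟨⟨dOcc_sec1_right hB i h1, dOcc_sec1_left hA i h1, h2⟩, h1⟩
    · apply congrArg Finset.card; apply Finset.filter_congr; intro γ _; constructor
      · rintro ⟨⟨h1, h2, h3⟩, h4⟩; exact ⟨h1, h2, h4, h3⟩
      · rintro ⟨h1, h2, h3, h4⟩; exact ⟨⟨h1, h2, h4⟩, h3⟩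
  -- (F4): `#{X ∧ ¬b0} = #{X ∧ ¬b1} + #{X ∧ b1 ∧ ¬b0}`
  have F4 : (U'.powerset.filter (fun γ => DOcc A (sec1 i B) γ ∧ ¬ B (U' \ γ))).card
      = (U'.powerset.filter (fun γ => DOcc A (sec1 i B) γ ∧ ¬ B (insert i (U' \ γ)))).card
        + (U'.powerset.filter (fun γ => DOcc A (sec1 i B) γ ∧ B (insert i (U' \ γ))
            ∧ ¬ B (U' \ γ))).card := by
    rw [← Finset.card_filter_add_card_filter_not (fun γ => B (insert i (U' \ γ)))
      (s := U'.powerset.filter (fun γ => DOcc A (sec1 i B) γ ∧ ¬ B (U' \ γ))),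
      Finset.filter_filter, Finset.filter_filter, Nat.add_comm]
    congr 1
    · apply congrArg Finset.card; apply Finset.filter_congr; intro γ _; constructor
      · rintro ⟨⟨h1, -⟩, h3⟩; exact ⟨h1, h3⟩
      · rintro ⟨h1, h2⟩; exact ⟨⟨h1, fun h => h2 (hB (Finset.subset_insert i _) h)⟩, h2⟩
    · apply congrArg Finset.card; apply Finset.filter_congr; intro γ _; constructor
      · rintro ⟨⟨h1, h2⟩, h3⟩; exact ⟨h1, h3, h2⟩
      · rintro ⟨h1, h2, h3⟩; exact ⟨⟨h1, h3⟩, h2⟩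
  -- (F5): `#{Z ∧ ¬b0} = #{Z ∧ ¬b1} + #{Z ∧ b1 ∧ ¬b0}`
  have F5 : (U'.powerset.filter (fun γ => DOcc A B γ ∧ ¬ B (U' \ γ))).card
      = (U'.powerset.filter (fun γ => DOcc A B γ ∧ ¬ B (insert i (U' \ γ)))).card
        + (U'.powerset.filter (fun γ => DOcc A B γ ∧ B (insert i (U' \ γ))
            ∧ ¬ B (U' \ γ))).card := by
    rw [← Finset.card_filter_add_card_filter_not (fun γ => B (insert i (U' \ γ)))
      (s := U'.powerset.filter (fun γ => DOcc A B γ ∧ ¬ B (U' \ γ))),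
      Finset.filter_filter, Finset.filter_filter, Nat.add_comm]
    congr 1
    · apply congrArg Finset.card; apply Finset.filter_congr; intro γ _; constructor
      · rintro ⟨⟨h1, -⟩, h3⟩; exact ⟨h1, h3⟩
      · rintro ⟨h1, h2⟩; exact ⟨⟨h1, fun h => h2 (hB (Finset.subset_insert i _) h)⟩, h2⟩
    · apply congrArg Finset.card; apply Finset.filter_congr; intro γ _; constructor
      · rintro ⟨⟨h1, h2⟩, h3⟩; exact ⟨h1, h3, h2⟩
      · rintro ⟨h1, h2, h3⟩; exact ⟨⟨h1, h3⟩, h2⟩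
  -- (F6): `#{X ∧ b1 ∧ ¬b0} = #{Z ∧ b1 ∧ ¬b0} + N_i`
  have F6 : (U'.powerset.filter (fun γ => DOcc A (sec1 i B) γ ∧ B (insert i (U' \ γ))
      ∧ ¬ B (U' \ γ))).card
      = (U'.powerset.filter (fun γ => DOcc A B γ ∧ B (insert i (U' \ γ)) ∧ ¬ B (U' \ γ))).card
        + cN U' A B i := by
    unfold cN
    rw [← Finset.card_filter_add_card_filter_not (fun γ => DOcc A B γ)
      (s := U'.powerset.filter (fun γ => DOcc A (sec1 i B) γ ∧ B (insert i (U' \ γ))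
        ∧ ¬ B (U' \ γ))), Finset.filter_filter, Finset.filter_filter]
    congr 1
    · apply congrArg Finset.card; apply Finset.filter_congr; intro γ _; constructor
      · rintro ⟨⟨-, h2, h3⟩, h4⟩; exact ⟨h4, h2, h3⟩
      · rintro ⟨h1, h2, h3⟩; exact ⟨⟨dOcc_sec1_right hB i h1, h2, h3⟩, h1⟩
    · apply congrArg Finset.card; apply Finset.filter_congr; intro γ _; constructor
      · rintro ⟨⟨h1, h2, h3⟩, h4⟩; exact ⟨h1, h4, h2, h3⟩
      · rintro ⟨h1, h2, h3, h4⟩; exact ⟨⟨h1, h3, h4⟩, h2⟩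
  -- assemble
  unfold Phi
  rw [hT, hL, hM, cL_sec1_right, cM_sec1_right, cL_sec1_left, cM_sec1_left]
  push_cast
  omega

end StepZero

end Summit.Ventures.PercRepro2
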